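import Summits.RiemannHypothesis.RiemannHypothesis.Theorems.PfPersistenceCoefficientRigidityEulerTower
import HarnessLib

/-!
# Coefficient rigidity of window positivity, V-b (preliminaries): overlap bounds, the isolation
gap of `log n₁`, and the site sum of a wave packet against a long coefficient sequence
(pub-rhpf cand-7, gen 9; mechanism/rigidity campaign; no RH claims)

Technical input for `PfPersistenceCoefficientRigiditySummable` (the `ℓ¹`-isolation of `ζ`'s
weight table).  ALL STATEMENTS ARE PROVED (no `sorry`, no new axioms, no RH anywhere in this
file); no sentence is DATA.

* `overlap_nonneg`, `overlap_le` (`0 ≤ I_R(x) ≤ 2R`), `abs_overlap_sub_overlap_zero_le_four_mul`,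
  `tsupport_wavePacket_subset` (`supp g_{R,t₀} ⊆ [-R, R]`).
* `log_gap_le` — `|log n - log n₁| ≥ log(n₁+1) - log n₁` for `n ≠ n₁`, `n, n₁ ≥ 2`.
* `trigSum_le_add_tail` — `P_N(t) ≤ P_{N'}(t) + ∑_{N'<n≤N} |c_n|` for the truncated cosine sums
  `P_N(t) = ∑_{2≤n≤N} c_n cos(t log n)`.
* `siteSum_wavePacket_le` — if `P_N(t₀) ≤ -δ ≤ 0` and the coefficient mass beyond `N₁` is `≤ η`:
  `∑_{2≤n≤N} 2c_n cos(t₀ log n) I_R(log n) ≤ -2Rδ + 4K ∑_{n≤N₁} |c_n| log n + 8Rη`.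

References: E. Bombieri, Rend. Lincei (9) 11 (2000) 183–233, §3 (the explicit formula set-up).
-/

set_option linter.dupNamespace false

noncomputable section

open Complex Filter Set MeasureTheory
open scoped Real Topology ComplexConjugate NNReal

namespace Summit.RiemannHypothesis.RiemannHypothesis.Theorems.PfPersistenceCoefficientRigidity

open Literature.NumberTheory.LFunctions
open Literature.NumberTheory.LFunctions.WeilConverse
open Summit.RiemannHypothesis.RiemannHypothesis.Theorems.PfPersistenceDownCone
open Summit.RiemannHypothesis.RiemannHypothesis.Theorems.PfPersistenceBarrier

/-! ## §25 More on the overlap integral and the wave packet -/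

/-- `I_R(x) ≥ 0`. [this work] -/
theorem overlap_nonneg (R x : ℝ) : 0 ≤ overlap R x :=
  integral_nonneg fun _ ↦ mul_nonneg plateau.nonneg plateau.nonneg

/-- `I_R(x) ≤ 2R`. [this work] -/
theorem overlap_le {R : ℝ} (hR : 0 < R) (x : ℝ) : overlap R x ≤ 2 * R := by
  unfold overlap
  have hvanish : ∀ u ∉ Icc (-R) R, plateau (u / R) * plateau ((u - x) / R) = 0 := fun u hu ↦ by
    rw [plateau_dilate_eq_zero hR hu, zero_mul]
  rw [← setIntegral_eq_integral_of_forall_compl_eq_zero hvanish]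
  calc ∫ u in Icc (-R) R, plateau (u / R) * plateau ((u - x) / R)
      ≤ ∫ _ in Icc (-R) R, (1 : ℝ) :=
        setIntegral_mono (integrable_plateau_overlap hR x).integrableOn
          continuous_const.integrableOn_Icc
          fun u ↦ mul_le_one₀ plateau.le_one plateau.nonneg plateau.le_one
    _ = 2 * R := by
        rw [setIntegral_const, Real.volume_real_Icc_of_le (by linarith), smul_eq_mul, mul_one]
        ring

/-- Crude bound `|I_R(x) - I_R(0)| ≤ 4R` (for the far sites). [this work] -/
theorem abs_overlap_sub_overlap_zero_le_four_mul {R : ℝ} (hR : 0 < R) (x : ℝ) :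
    |overlap R x - overlap R 0| ≤ 4 * R := by
  rw [abs_le]
  constructor
  · linarith [overlap_nonneg R x, overlap_le hR 0]
  · linarith [overlap_nonneg R 0, overlap_le hR x]

/-- The wave packet `g_{R,t₀}` is supported in `[-R, R]`. [this work] -/
theorem tsupport_wavePacket_subset {R : ℝ} (hR : 0 < R) (t₀ : ℝ) :
    tsupport (wavePacket R t₀) ⊆ Icc (-R) R := by
  refine closure_minimal (fun t ht ↦ ?_) isClosed_Icc
  by_contra hmem
  apply ht
  simp only [wavePacket, plateauC, plateau_dilate_eq_zero hR hmem, Complex.ofReal_zero, zero_mul]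

/-! ## §26 The isolation gap of `log n₁` among the `log n`, `n ≥ 2` -/

/-- `|log n - log n₁| ≥ log(n₁ + 1) - log n₁ > 0` for `n ≠ n₁`, `n, n₁ ≥ 2`. [folklore] -/
theorem log_gap_le {n n₁ : ℕ} (hn : 2 ≤ n) (hn₁ : 2 ≤ n₁) (hne : n ≠ n₁) :
    Real.log ((n₁ : ℝ) + 1) - Real.log n₁ ≤ |Real.log (n : ℝ) - Real.log n₁| := by
  have hn0 : (0 : ℝ) < n := by exact_mod_cast (by omega : 0 < n)
  have hn₁0 : (0 : ℝ) < n₁ := by exact_mod_cast (by omega : 0 < n₁)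
  rcases Nat.lt_or_gt_of_ne hne with h | h
  · -- `n < n₁`: `log n₁ - log n ≥ log n₁ - log(n₁ - 1) ≥ log(n₁ + 1) - log n₁`
    have hle : (n : ℝ) ≤ (n₁ : ℝ) - 1 := by
      have : n + 1 ≤ n₁ := h
      have : ((n : ℝ) + 1) ≤ n₁ := by exact_mod_cast this
      linarith
    have hpos : (0 : ℝ) < (n₁ : ℝ) - 1 := by linarith
    rw [abs_sub_comm, abs_of_nonneg (by linarith [Real.log_le_log hn0 (by linarith : (n:ℝ) ≤ n₁)])]
    have h1 : Real.log (n : ℝ) ≤ Real.log ((n₁ : ℝ) - 1) := Real.log_le_log hn0 hle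
    have h2 : Real.log ((n₁ : ℝ) - 1) + Real.log ((n₁ : ℝ) + 1) ≤ 2 * Real.log n₁ := by
      rw [← Real.log_mul hpos.ne' (by linarith : ((n₁ : ℝ) + 1) ≠ 0),
        show (2 : ℝ) * Real.log n₁ = Real.log ((n₁ : ℝ) ^ 2) by
          rw [Real.log_pow]; norm_num]
      exact Real.log_le_log (by positivity) (by nlinarith)
    linarith
  · -- `n₁ < n`
    have hle : (n₁ : ℝ) + 1 ≤ n := by exact_mod_cast h
    have h1 : Real.log ((n₁ : ℝ) + 1) ≤ Real.log n := Real.log_le_log (by linarith) hle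
    have h2 : Real.log (n₁ : ℝ) ≤ Real.log ((n₁ : ℝ) + 1) := Real.log_le_log hn₁0 (by linarith)
    rw [abs_of_nonneg (by linarith)]
    linarith

/-! ## §27 Tails and the site sum of a wave packet (helpers for the RH branch) -/

/-- `a cos θ ≤ |a|`. [folklore] -/
theorem mul_cos_le_abs (a θ : ℝ) : a * Real.cos θ ≤ |a| := by
  refine (le_abs_self _).trans ?_
  rw [abs_mul]
  exact mul_le_of_le_one_right (abs_nonneg _) (Real.abs_cos_le_one _)

/-- Tail comparison of the truncated cosine sums `P_N(t) = ∑_{2 ≤ n ≤ N} c_n cos(t log n)`: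
`P_N(t) ≤ P_{N'}(t) + ∑_{N' < n ≤ N} |c_n|`. [this work] -/
theorem trigSum_le_add_tail (c : ℕ → ℝ) (t : ℝ) {N' N : ℕ} (h1 : 1 ≤ N') (hN : N' ≤ N) :
    ∑ n ∈ Finset.Ico 2 (N + 1), c n * Real.cos (t * Real.log (n : ℝ)) ≤
      ∑ n ∈ Finset.Ico 2 (N' + 1), c n * Real.cos (t * Real.log (n : ℝ)) +
        ∑ n ∈ Finset.Ico (N' + 1) (N + 1), |c n| := by
  rw [← Finset.sum_Ico_consecutive (fun n : ℕ ↦ c n * Real.cos (t * Real.log (n : ℝ)))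
    (show 2 ≤ N' + 1 by omega) (show N' + 1 ≤ N + 1 by omega)]
  have h := Finset.sum_le_sum (s := Finset.Ico (N' + 1) (N + 1))
    fun n _ ↦ mul_cos_le_abs (c n) (t * Real.log (n : ℝ))
  linarith

/-- **Site sum of a wave packet against a long coefficient sequence.**  If `P_N(t₀) ≤ -δ ≤ 0`
and the coefficients beyond `N₁` have mass `≤ η`, then
`∑_{2≤n≤N} 2 c_n cos(t₀ log n) I_R(log n) ≤ -2Rδ + 4K ∑_{2≤n≤N₁} |c_n| log n + 8Rη`
(near sites: Lipschitz overlap approximation; far sites: `|I_R(x) - I_R(0)| ≤ 4R`). [this work] -/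
theorem siteSum_wavePacket_le {c : ℕ → ℝ} {R : ℝ} (hR0 : 0 < R) (t₀ : ℝ) {K : ℝ≥0}
    (hK : LipschitzWith K (plateau : ℝ → ℝ)) {N₁ N : ℕ} (h1 : 1 ≤ N₁) (hN : N₁ ≤ N) {δ η : ℝ}
    (hδ : 0 ≤ δ)
    (hP : ∑ n ∈ Finset.Ico 2 (N + 1), c n * Real.cos (t₀ * Real.log (n : ℝ)) ≤ -δ)
    (hη : ∑ n ∈ Finset.Ico (N₁ + 1) (N + 1), |c n| ≤ η) :
    ∑ n ∈ Finset.Ico 2 (N + 1),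
        2 * c n * (Real.cos (t₀ * Real.log (n : ℝ)) * overlap R (Real.log (n : ℝ))) ≤
      -(2 * R * δ) + 4 * K * (∑ n ∈ Finset.Ico 2 (N₁ + 1), |c n| * Real.log (n : ℝ)) +
        8 * R * η := by
  have hK0 : (0 : ℝ) ≤ K := K.2
  have hsplit : ∑ n ∈ Finset.Ico 2 (N + 1),
      2 * c n * (Real.cos (t₀ * Real.log (n : ℝ)) * overlap R (Real.log (n : ℝ))) =
      2 * overlap R 0 * ∑ n ∈ Finset.Ico 2 (N + 1), c n * Real.cos (t₀ * Real.log (n : ℝ)) +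
        2 * ∑ n ∈ Finset.Ico 2 (N + 1), c n * Real.cos (t₀ * Real.log (n : ℝ)) *
          (overlap R (Real.log (n : ℝ)) - overlap R 0) := by
    rw [Finset.mul_sum, Finset.mul_sum, ← Finset.sum_add_distrib]
    exact Finset.sum_congr rfl fun n _ ↦ by ring
  have hO0 : R ≤ overlap R 0 := le_overlap_zero hR0
  have hmain : 2 * overlap R 0 * ∑ n ∈ Finset.Ico 2 (N + 1),
      c n * Real.cos (t₀ * Real.log (n : ℝ)) ≤ -(2 * R * δ) := by
    set P := ∑ n ∈ Finset.Ico 2 (N + 1), c n * Real.cos (t₀ * Real.log (n : ℝ)) with hPdef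
    have hPneg : P ≤ 0 := by linarith
    have h1 : overlap R 0 * P ≤ R * P := mul_le_mul_of_nonpos_right hO0 hPneg
    have h2 : R * P ≤ R * (-δ) := mul_le_mul_of_nonneg_left hP hR0.le
    have e : 2 * overlap R 0 * P = 2 * (overlap R 0 * P) := by ring
    rw [e]
    linarith
  have hterm : ∀ n : ℕ, ∀ B : ℝ, |overlap R (Real.log (n : ℝ)) - overlap R 0| ≤ B →
      c n * Real.cos (t₀ * Real.log (n : ℝ)) * (overlap R (Real.log (n : ℝ)) - overlap R 0) ≤
        |c n| * B := by
    intro n B hB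
    have h2 : |c n * Real.cos (t₀ * Real.log (n : ℝ))| ≤ |c n| := by
      rw [abs_mul]
      exact mul_le_of_le_one_right (abs_nonneg _) (Real.abs_cos_le_one _)
    calc c n * Real.cos (t₀ * Real.log (n : ℝ)) * (overlap R (Real.log (n : ℝ)) - overlap R 0)
        ≤ |c n * Real.cos (t₀ * Real.log (n : ℝ)) *
            (overlap R (Real.log (n : ℝ)) - overlap R 0)| := le_abs_self _
      _ = |c n * Real.cos (t₀ * Real.log (n : ℝ))| *
            |overlap R (Real.log (n : ℝ)) - overlap R 0| := abs_mul _ _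
      _ ≤ |c n| * B := mul_le_mul h2 hB (abs_nonneg _) (abs_nonneg _)
  have hnear : ∑ n ∈ Finset.Ico 2 (N₁ + 1), c n * Real.cos (t₀ * Real.log (n : ℝ)) *
      (overlap R (Real.log (n : ℝ)) - overlap R 0) ≤
        2 * K * ∑ n ∈ Finset.Ico 2 (N₁ + 1), |c n| * Real.log (n : ℝ) := by
    rw [Finset.mul_sum]
    refine Finset.sum_le_sum fun n hn ↦ ?_
    have hn2 : (2 : ℝ) ≤ n := by exact_mod_cast (Finset.mem_Ico.1 hn).1
    have hx : 0 < Real.log (n : ℝ) := Real.log_pos (by linarith)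
    have h1 : |overlap R (Real.log (n : ℝ)) - overlap R 0| ≤ 2 * (K : ℝ) * Real.log (n : ℝ) := by
      have h := abs_overlap_sub_overlap_zero_le hR0 hK (Real.log (n : ℝ))
      rwa [abs_of_pos hx] at h
    have h := hterm n _ h1
    calc _ ≤ |c n| * (2 * (K : ℝ) * Real.log (n : ℝ)) := h
      _ = 2 * K * (|c n| * Real.log (n : ℝ)) := by ring
  have hfar : ∑ n ∈ Finset.Ico (N₁ + 1) (N + 1), c n * Real.cos (t₀ * Real.log (n : ℝ)) *
      (overlap R (Real.log (n : ℝ)) - overlap R 0) ≤ 4 * R * η := by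
    calc ∑ n ∈ Finset.Ico (N₁ + 1) (N + 1), c n * Real.cos (t₀ * Real.log (n : ℝ)) *
          (overlap R (Real.log (n : ℝ)) - overlap R 0)
        ≤ ∑ n ∈ Finset.Ico (N₁ + 1) (N + 1), 4 * R * |c n| :=
          Finset.sum_le_sum fun n _ ↦ by
            have h := hterm n _ (abs_overlap_sub_overlap_zero_le_four_mul hR0 (Real.log (n : ℝ)))
            linarith
      _ = 4 * R * ∑ n ∈ Finset.Ico (N₁ + 1) (N + 1), |c n| := by rw [Finset.mul_sum]
      _ ≤ 4 * R * η := mul_le_mul_of_nonneg_left hη (by positivity)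
  have herr : ∑ n ∈ Finset.Ico 2 (N + 1), c n * Real.cos (t₀ * Real.log (n : ℝ)) *
      (overlap R (Real.log (n : ℝ)) - overlap R 0) ≤
        2 * K * (∑ n ∈ Finset.Ico 2 (N₁ + 1), |c n| * Real.log (n : ℝ)) + 4 * R * η := by
    rw [← Finset.sum_Ico_consecutive (fun n : ℕ ↦ c n * Real.cos (t₀ * Real.log (n : ℝ)) *
      (overlap R (Real.log (n : ℝ)) - overlap R 0))
      (show 2 ≤ N₁ + 1 by omega) (show N₁ + 1 ≤ N + 1 by omega)]
    linarith
  rw [hsplit]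
  linarith

end Summit.RiemannHypothesis.RiemannHypothesis.Theorems.PfPersistenceCoefficientRigidity

end
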